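import Literature.AlgebraicGeometry.HodgeTheory.WeilClassesMoonenZarhinCriterionHolds
import Literature.AlgebraicGeometry.HodgeTheory.HodgeClassesIsogenyInvariance
import Mathlib.RingTheory.Polynomial.Cyclotomic.Roots
import HarnessLib

/-!
# Weil-type ladder — eigen-calculus helpers for the twisted composite families (cyclotomic eigenvalues, wedges of four classes)

b2b cell `hweil` (packet `run/shared/lean/b2b/hodge-weil/`), prover 3; small self-contained lemmas used by the kernel form
of THEOREM EXC (report `b2b-hweil-pv3-g46/COMPACT-PAIRS.md` §7): equality of vectors through their pairings with a
basis, the reproducing property of a dual basis and the eigen-property of the dual basis of an eigenbasis of an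
isometry of finite order (`apply_dualBasis_eq_pow_smul`), primitive roots of unity (conjugates, the twist `c ↦ conj(c)^u`) and `Φ_m(s) = 0 ⟹ s^m = 1` in a ring
(complex roots of `Φ_m` are primitive: `isPrimitiveRoot_of_eval₂_cyclotomic` of `…CyclicPrymQuarticCMField`), the
span of the eigenvectors of a diagonalised operator, linear independence of four vectors taken from two disjoint
subspaces, the symmetries of the four-fold cup product `x₁ ⌣ y₁ ⌣ x₂ ⌣ y₂`, the bilinear expansion of a cup product of
two sums, and the stability of a pull-back-stable subspace under polynomials in the pull-back.

Everything is proved; no definition, no named fact, no `sorry`; imports `Literature.*` + Mathlib + `HarnessLib` only.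
HONEST LABEL: linear algebra / bookkeeping; nothing here is a rung; Markman-free.
[cite: HatcherAT2002, §3.2 Prop. 3.10 and Thm. 3.11] [cite: Rohde2009CyclicCoverings, Ch. 6 §6.4]
-/

noncomputable section

-- every declaration of this problem lives in `Summit.HodgeConjecture.HodgeConjecture.…` (summit = sub-problem)
set_option linter.dupNamespace false

open CategoryTheory Polynomial
open Literature.AlgebraicGeometry Literature.AlgebraicGeometry.Motives
open Literature.AlgebraicGeometry.HodgeTheory
open Literature.AlgebraicTopology.SingularHomology

namespace Summit.HodgeConjecture.HodgeConjecture.WeilTypeLadder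

/-! ### §1 Bilinear forms: equality through a basis, dual bases of eigenbases -/

section Generic

variable {K V : Type*} [Field K] [AddCommGroup V] [Module K V] {ι : Type*}

/-- Two vectors with the same pairings against a basis are equal (left non-degeneracy). [folklore] -/
theorem eq_of_forall_form_basis (Ψ : LinearMap.BilinForm K V) (hΨ : Ψ.Nondegenerate) (b : Module.Basis ι K V)
    {v w : V} (h : ∀ k, Ψ v (b k) = Ψ w (b k)) : v = w := by
  have h0 : Ψ (v - w) = 0 :=
    b.ext fun k => by rw [map_sub, LinearMap.sub_apply, h k, sub_self, LinearMap.zero_apply]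
  exact sub_eq_zero.1 (hΨ.1 _ fun y => by rw [h0, LinearMap.zero_apply])

/-- If `Ψ(d_j, b_k) = δ_{jk}` for a basis `b` and a family `d`, then `d` separates: `Ψ(d_j, y) = 0` for all `j`
forces `y = 0` (the `b`-coordinates of `y` are the numbers `Ψ(d_j, y)`). [folklore] -/
theorem eq_zero_of_forall_form_eq_zero_of_dual [Fintype ι] [DecidableEq ι] (Ψ : LinearMap.BilinForm K V)
    (b : Module.Basis ι K V) (d : ι → V)
    (hdual : ∀ j k, Ψ (d j) (b k) = if k = j then 1 else 0) {y : V} (h : ∀ j, Ψ (d j) y = 0) : y = 0 := by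
  have hrepr : ∀ j, b.repr y j = Ψ (d j) y := fun j => by
    conv_rhs => rw [← b.sum_repr y]
    rw [map_sum]
    simp only [map_smul, smul_eq_mul, hdual, mul_ite, mul_one, mul_zero, Finset.sum_ite_eq', Finset.mem_univ,
      if_true]
  exact b.ext_elem fun j => by rw [hrepr, h j, map_zero, Finsupp.zero_apply]

/-- The vectors of a `Ψ`-dual basis separate: `Ψ(d_j, y) = 0` for all `j` forces `y = 0`. [folklore] -/
theorem eq_zero_of_forall_dualBasis_form_eq_zero [Fintype ι] [DecidableEq ι] (Ψ : LinearMap.BilinForm K V)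
    (hΨ : Ψ.Nondegenerate) (b : Module.Basis ι K V) {y : V} (h : ∀ j, Ψ (Ψ.dualBasis hΨ b j) y = 0) : y = 0 :=
  eq_zero_of_forall_form_eq_zero_of_dual Ψ b (Ψ.dualBasis hΨ b)
    (fun j k => LinearMap.BilinForm.apply_dualBasis_left hΨ b j k) h

/-- The reproducing property of a basis and its `Ψ`-dual basis: `x = Σ_j Ψ(x, b_j) d_j`. [folklore] -/
theorem eq_sum_form_smul_dualBasis [Fintype ι] [DecidableEq ι] (Ψ : LinearMap.BilinForm K V)
    (hΨ : Ψ.Nondegenerate) (b : Module.Basis ι K V) (x : V) : x = ∑ j, Ψ x (b j) • Ψ.dualBasis hΨ b j := by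
  conv_lhs => rw [← (Ψ.dualBasis hΨ b).sum_repr x]
  simp only [LinearMap.BilinForm.dualBasis_repr_apply]

/-- Powers of an operator on an eigenvector. [folklore] -/
theorem pow_apply_of_apply_eq_smul (T : Module.End K V) {v : V} {c : K} (hv : T v = c • v) (n : ℕ) :
    (T ^ n) v = c ^ n • v := by
  induction n with
  | zero => rw [pow_zero, pow_zero, one_smul, Module.End.one_apply]
  | succ n ih => rw [pow_succ, Module.End.mul_apply, hv, map_smul, ih, smul_smul, ← pow_succ']

/-- **The dual basis of an eigenbasis of an isometry of finite order is an eigenbasis for the inverse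
eigenvalues**: if `Ψ(Tx, Ty) = Ψ(x, y)`, `T^m = 1` (`m ≥ 1`) and `T b_k = λ_k b_k` for all `k`, then
`T d_j = λ_j^{m-1} d_j` for the `Ψ`-dual basis `d` (`Ψ(d_j, b_k) = δ_{jk}`): pair both sides with
`b_k = T(T^{m-1} b_k)`. [folklore] -/
theorem apply_dualBasis_eq_pow_smul [Fintype ι] [DecidableEq ι] (Ψ : LinearMap.BilinForm K V)
    (hΨ : Ψ.Nondegenerate) (T : Module.End K V) (hT : ∀ x y, Ψ (T x) (T y) = Ψ x y) {m : ℕ} (hm : 0 < m) (hTm : T ^ m = 1) (b : Module.Basis ι K V)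
    (lam : ι → K) (hb : ∀ k, T (b k) = lam k • b k) (j : ι) :
    T (Ψ.dualBasis hΨ b j) = lam j ^ (m - 1) • Ψ.dualBasis hΨ b j := by
  refine eq_of_forall_form_basis Ψ hΨ b fun k => ?_
  have hk : b k = T ((T ^ (m - 1)) (b k)) := by
    rw [← Module.End.mul_apply, ← pow_succ', Nat.sub_add_cancel hm, hTm, Module.End.one_apply]
  conv_lhs => rw [hk, hT, pow_apply_of_apply_eq_smul T (hb k) (m - 1)]
  rw [map_smul, map_smul, LinearMap.smul_apply, LinearMap.BilinForm.apply_dualBasis_left, smul_eq_mul,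
    smul_eq_mul]
  by_cases hkj : k = j
  · subst hkj; rw [if_pos rfl]
  · rw [if_neg hkj, mul_zero, mul_zero]

end Generic

/-! ### §2 Roots of `Φ_m` -/

section Cyclotomic

/-- A primitive root of unity is non-zero, and its complex conjugate is its inverse and its `(m-1)`-st power.
[folklore] -/
theorem conj_eq_pow_of_isPrimitiveRoot {m : ℕ} (hm : 0 < m) {c : ℂ} (hc : IsPrimitiveRoot c m) :
    c ≠ 0 ∧ starRingEnd ℂ c = c⁻¹ ∧ starRingEnd ℂ c = c ^ (m - 1) := by
  have h1 : c ^ m = 1 := hc.pow_eq_one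
  have hc0 : c ≠ 0 := hc.ne_zero hm.ne'
  have hnorm : ‖c‖ = 1 := Complex.norm_eq_one_of_pow_eq_one h1 hm.ne'
  have hinv : starRingEnd ℂ c = c⁻¹ := (Complex.inv_eq_conj hnorm).symm
  refine ⟨hc0, hinv, ?_⟩
  rw [hinv, inv_eq_iff_eq_inv, ← mul_eq_one_iff_eq_inv₀ (pow_ne_zero _ hc0), ← pow_succ',
    Nat.sub_add_cancel hm, h1]

/-- **`Φ_m(s) = 0 ⟹ s^m = 1`** in any ring (`Φ_m ∣ T^m − 1` in `ℤ[T]`). [folklore] -/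
theorem pow_eq_one_of_eval₂_cyclotomic {R : Type*} [Ring R] {m : ℕ} (s : R)
    (hs : Polynomial.eval₂ (Int.castRingHom R) s (Polynomial.cyclotomic m ℤ) = 0) : s ^ m = 1 := by
  obtain ⟨q, hq⟩ := Polynomial.cyclotomic.dvd_X_pow_sub_one m ℤ
  have h : Polynomial.aeval s (X ^ m - 1 : Polynomial ℤ) = 0 := by
    rw [hq, map_mul, Polynomial.aeval_def, algebraMap_int_eq, hs, zero_mul]
  rw [map_sub, map_pow, Polynomial.aeval_X, map_one, sub_eq_zero] at h
  exact h

/-- From `u·u ≡ 1 (mod m)` with `m ≥ 2`: `u·u = m·k + 1` for some `k`. [folklore] -/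
theorem exists_mul_self_eq_of_modEq {m u : ℕ} (hm : 2 ≤ m) (hu : u * u ≡ 1 [MOD m]) : ∃ k, u * u = m * k + 1 := by
  refine ⟨u * u / m, ?_⟩
  have h := Nat.div_add_mod (u * u) m
  rw [Nat.ModEq, Nat.mod_eq_of_lt (show 1 < m by omega)] at hu
  rw [hu] at h
  exact h.symm

/-- For a primitive `m`-th root `c` and `u·u ≡ 1 (mod m)`: `(conj (conj c ^ u)) ^ u = c` and `conj c ^ u` is again
a primitive `m`-th root. [folklore] -/
theorem conj_pow_conj_pow {m u : ℕ} (hm : 2 ≤ m) (hu : u * u ≡ 1 [MOD m]) {c : ℂ} (hc : IsPrimitiveRoot c m) :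
    (starRingEnd ℂ (starRingEnd ℂ c ^ u)) ^ u = c ∧ IsPrimitiveRoot (starRingEnd ℂ c ^ u) m := by
  obtain ⟨k, hk⟩ := exists_mul_self_eq_of_modEq hm hu
  obtain ⟨hc0, hinv, -⟩ := conj_eq_pow_of_isPrimitiveRoot (by omega) hc
  have hcop : u.Coprime m := by
    rw [Nat.coprime_comm, Nat.coprime_iff_gcd_eq_one]
    have h1 : Nat.gcd m u ∣ 1 := by
      have hd : Nat.gcd m u ∣ u * u := Dvd.dvd.mul_left (Nat.gcd_dvd_right m u) u
      rw [hk] at hd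
      exact (Nat.dvd_add_right (Dvd.dvd.mul_right (Nat.gcd_dvd_left m u) k)).1 hd
    exact Nat.dvd_one.1 h1
  refine ⟨?_, ?_⟩
  · rw [map_pow, Complex.conj_conj, ← pow_mul, hk, pow_add, pow_mul, hc.pow_eq_one, one_pow, one_mul, pow_one]
  · rw [hinv]; exact hc.inv.pow_of_coprime u hcop

end Cyclotomic

/-! ### §3 Linear algebra: eigen-spans, independence, polynomial stability -/

section LinearAlgebra

variable {K V : Type*} [Field K] [AddCommGroup V] [Module K V]

/-- **The eigenspace of a diagonalised operator is spanned by the basis vectors with that eigenvalue.**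
[folklore] -/
theorem eigenspace_eq_span_image {N : ℕ} (b : Module.Basis (Fin N) K V) (T : Module.End K V) (lam : Fin N → K)
    (hb : ∀ j, T (b j) = lam j • b j) (c : K) :
    Module.End.eigenspace T c = Submodule.span K (b '' {j | lam j = c}) := by
  ext v
  rw [Module.End.mem_eigenspace_iff]
  have h := forall_apply_eq_smul_iff_mem_span_image (P := Unit) b (fun _ => T) (fun j _ => lam j)
    (fun _ j => hb j) (fun _ => c) v
  have hset : {j : Fin N | (fun _ : Unit => lam j) = fun _ => c} = {j | lam j = c} := by
    ext j
    simp only [Set.mem_setOf_eq]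
    exact ⟨fun h => congrFun h (), fun h => funext fun _ => h⟩
  rw [hset] at h
  exact ⟨fun hv => h.1 fun _ => hv, fun hv => (h.2 hv) ()⟩

/-- The dimension of the eigenspace of a diagonalised operator is the number of basis vectors with that
eigenvalue. [folklore] -/
theorem finrank_eigenspace_eq_card [DecidableEq K] {N : ℕ} (b : Module.Basis (Fin N) K V) (T : Module.End K V)
    (lam : Fin N → K) (hb : ∀ j, T (b j) = lam j • b j) (c : K) :
    Module.finrank K (Module.End.eigenspace T c) = (Finset.univ.filter fun j => lam j = c).card := by
  classical
  rw [eigenspace_eq_span_image b T lam hb c]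
  have hrange : b '' {j | lam j = c} = Set.range (fun j : {j // lam j = c} => b j) := by
    ext v; simp
  have hli : LinearIndependent K (fun j : {j // lam j = c} => b j) :=
    b.linearIndependent.comp _ Subtype.val_injective
  rw [hrange, finrank_span_eq_card hli, Fintype.card_subtype]

/-- **Four vectors from two disjoint subspaces**: if `x₁, x₂ ∈ V₁` are independent, `y₁, y₂ ∈ V₂` are independent
and `V₁ ⊓ V₂ = 0`, then `(x₁, y₁, x₂, y₂)` is linearly independent. [folklore] -/
theorem linearIndependent_four_of_disjoint (V₁ V₂ : Submodule K V) (hdis : Disjoint V₁ V₂) {x₁ x₂ y₁ y₂ : V}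
    (hx₁ : x₁ ∈ V₁) (hx₂ : x₂ ∈ V₁) (hy₁ : y₁ ∈ V₂) (hy₂ : y₂ ∈ V₂) (hx : LinearIndependent K ![x₁, x₂])
    (hy : LinearIndependent K ![y₁, y₂]) : LinearIndependent K ![x₁, y₁, x₂, y₂] := by
  rw [Fintype.linearIndependent_iff]
  intro g hg
  rw [Fin.sum_univ_four] at hg
  simp only [Matrix.cons_val_zero, Matrix.cons_val_one, Matrix.cons_val] at hg
  have hX : g 0 • x₁ + g 2 • x₂ ∈ V₁ := V₁.add_mem (V₁.smul_mem _ hx₁) (V₁.smul_mem _ hx₂)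
  have hY : g 1 • y₁ + g 3 • y₂ ∈ V₂ := V₂.add_mem (V₂.smul_mem _ hy₁) (V₂.smul_mem _ hy₂)
  have hsum : (g 0 • x₁ + g 2 • x₂) + (g 1 • y₁ + g 3 • y₂) = 0 := by rw [← hg]; abel
  have hX0 : g 0 • x₁ + g 2 • x₂ = 0 := by
    refine (Submodule.disjoint_def.1 hdis) _ hX ?_
    have : g 0 • x₁ + g 2 • x₂ = -(g 1 • y₁ + g 3 • y₂) := eq_neg_of_add_eq_zero_left hsum
    rw [this]; exact V₂.neg_mem hY
  have hY0 : g 1 • y₁ + g 3 • y₂ = 0 := by rwa [hX0, zero_add] at hsum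
  obtain ⟨h0, h2⟩ := LinearIndependent.pair_iff.1 hx (g 0) (g 2) hX0
  obtain ⟨h1, h3⟩ := LinearIndependent.pair_iff.1 hy (g 1) (g 3) hY0
  intro i
  fin_cases i <;> assumption

/-- **A subspace stable under an operator is stable under every polynomial in it.** [folklore] -/
theorem aeval_apply_mem_of_forall_mem (S : Submodule K V) (T : Module.End K V) (hT : ∀ v ∈ S, T v ∈ S)
    (p : K[X]) {v : V} (hv : v ∈ S) : Polynomial.aeval T p v ∈ S := by
  induction p using Polynomial.induction_on' with
  | add p q hp hq => rw [map_add, LinearMap.add_apply]; exact S.add_mem hp hq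
  | monomial n a =>
    rw [Polynomial.aeval_monomial, Module.End.mul_apply, Module.algebraMap_end_apply]
    refine S.smul_mem a ?_
    induction n with
    | zero => rwa [pow_zero, Module.End.one_apply]
    | succ n ih => rw [pow_succ', Module.End.mul_apply]; exact hT _ ih

/-- A polynomial in an operator acts on an eigenvector by the value of the polynomial (zero vector allowed).
[folklore] -/
theorem aeval_apply_of_eq_smul (T : Module.End K V) (p : K[X]) {μ : K} {v : V} (hv : T v = μ • v) :
    Polynomial.aeval T p v = p.eval μ • v := by
  by_cases h0 : v = 0
  · rw [h0, map_zero, smul_zero]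
  · exact Module.End.aeval_apply_of_hasEigenvector (Module.End.hasEigenvector_iff.2 ⟨Module.End.mem_eigenspace_iff.2 hv, h0⟩)

end LinearAlgebra

/-! ### §4 Cup products: four-fold wedges, expansion of products of sums -/

section Cup

variable {Y : Type} [TopologicalSpace Y]

/-- `Fin.append` of two pairs is the quadruple. [folklore] -/
theorem append_two_two {α : Type*} (a b c d : α) : Fin.append ![a, b] ![c, d] = ![a, b, c, d] := by
  funext i
  fin_cases i <;> rfl

/-- **`(x₁ ⌣ y₁) ⌣ (x₂ ⌣ y₂) = x₁ ⌣ y₁ ⌣ x₂ ⌣ y₂`** (associativity of the cup product; degrees `2 + 2 = 4`).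
[cite: HatcherAT2002, §3.2 p. 211] -/
theorem cupProduct_cupPowOne_two_two (x₁ y₁ x₂ y₂ : singularCohomology ℂ ℂ Y 1) :
    cupProduct (rfl : 2 + 2 = 4) (cupPowOne ℂ Y 2 ![x₁, y₁]) (cupPowOne ℂ Y 2 ![x₂, y₂]) =
      cupPowOne ℂ Y 4 ![x₁, y₁, x₂, y₂] := by
  rw [← append_two_two]
  exact cupProduct_cupPowOne_cupPowOne ℂ ![x₁, y₁] ![x₂, y₂]

/-- A four-fold product with a repeated pair vanishes: `x ⌣ y ⌣ x ⌣ y = 0`. [cite: HatcherAT2002, Thm. 3.11] -/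
theorem cupPowOne_four_eq_zero_of_repeat (x y : singularCohomology ℂ ℂ Y 1) : cupPowOne ℂ Y 4 ![x, y, x, y] = 0 :=
  cupPowOne_eq_zero_of_eq 4 ![x, y, x, y] 0 2 rfl (by decide)

/-- Exchanging the two pairs does not change the four-fold product (an even permutation):
`x₂ ⌣ y₂ ⌣ x₁ ⌣ y₁ = x₁ ⌣ y₁ ⌣ x₂ ⌣ y₂`. [cite: HatcherAT2002, Thm. 3.11] -/
theorem cupPowOne_four_swap_pairs (x₁ y₁ x₂ y₂ : singularCohomology ℂ ℂ Y 1) :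
    cupPowOne ℂ Y 4 ![x₂, y₂, x₁, y₁] = cupPowOne ℂ Y 4 ![x₁, y₁, x₂, y₂] := by
  classical
  let σ : Equiv.Perm (Fin 4) := Equiv.swap 0 2 * Equiv.swap 1 3
  have hv : (![x₂, y₂, x₁, y₁] : Fin 4 → singularCohomology ℂ ℂ Y 1) = ![x₁, y₁, x₂, y₂] ∘ σ := by
    funext i
    fin_cases i <;> rfl
  have hsign : Equiv.Perm.sign σ = 1 := by decide
  rw [← cupPowOneAlt_apply, ← cupPowOneAlt_apply, hv, AlternatingMap.map_perm, hsign, one_smul]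

/-- **Bilinear expansion**: `(Σ_{j∈A} α_j g_j) ⌣ (Σ_{j'∈A'} β_{j'} g'_{j'}) = Σ_{j∈A} Σ_{j'∈A'} α_j β_{j'} (g_j ⌣ g'_{j'})`.
[cite: HatcherAT2002, §3.2] -/
theorem cupProduct_sum_smul_sum_smul {p q n : ℕ} (h : p + q = n) {ι : Type*} (A A' : Finset ι) (α β : ι → ℂ)
    (g : ι → singularCohomology ℂ ℂ Y p) (g' : ι → singularCohomology ℂ ℂ Y q) :
    cupProduct h (∑ j ∈ A, α j • g j) (∑ j' ∈ A', β j' • g' j') =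
      ∑ j ∈ A, ∑ j' ∈ A', (α j * β j') • cupProduct h (g j) (g' j') := by
  rw [map_sum]
  simp_rw [LinearMap.map_smul, map_sum, LinearMap.sum_apply, LinearMap.map_smul, LinearMap.smul_apply,
    Finset.smul_sum, smul_smul]
  rw [Finset.sum_comm]
  exact Finset.sum_congr rfl fun j _ => Finset.sum_congr rfl fun j' _ => by rw [mul_comm]

end Cup

/-! ### §5 Pull-backs: joint eigenclasses of degree four, stability of the divisor ring -/

section Pullback

variable {B : AbelianVariety ℂ}

/-- Membership of all four entries of a quadruple. [folklore] -/
theorem forall_vecCons_four {α : Type*} (S : Set α) {a b c d : α} (ha : a ∈ S) (hb : b ∈ S) (hc : c ∈ S)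
    (hd : d ∈ S) : ∀ i : Fin 4, (![a, b, c, d] : Fin 4 → α) i ∈ S := by
  intro i
  fin_cases i <;> assumption

/-- **The test pull-back `(x·𝟙 + 1·φ)^*` on a four-fold product of `φ^*`-eigenvectors** acts by the product of the
four numbers `x + q_i`. [cite: HatcherAT2002, §3.2 Prop. 3.10] -/
theorem map_cupPowOne_four_of_mem_eigenspace (φ : B ⟶ B) (x : ℕ) (w : Fin 4 → complexBetti B.X 1) (q : Fin 4 → ℂ)
    (hw : ∀ i, w i ∈ Module.End.eigenspace (complexBetti.map φ.hom.hom.hom 1).hom (q i)) :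
    (complexBetti.map (x • 𝟙 B + (1 : ℕ) • φ).hom.hom.hom 4).hom (cupPowOne ℂ (Motives.ComplexPoints B.X) 4 w) =
      (∏ i, ((x : ℂ) + q i)) • cupPowOne ℂ (Motives.ComplexPoints B.X) 4 w := by
  change singularCohomology.map ℂ ℂ (Motives.AlgPoints.mapContinuous (L := ℂ) (x • 𝟙 B + (1 : ℕ) • φ).hom.hom.hom) 4
    (cupPowOne ℂ _ 4 w) = _
  rw [map_cupPowOne]
  have e : (fun i => singularCohomology.map ℂ ℂ
      (Motives.AlgPoints.mapContinuous (L := ℂ) (x • 𝟙 B + (1 : ℕ) • φ).hom.hom.hom) 1 (w i)) =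
      fun i => ((x : ℂ) + q i) • w i := by
    funext i
    have h := complexBetti_map_nsmul_id_add_nsmul_one_of_mem_eigenspace (hw i) x 1
    rw [Nat.cast_one, one_mul] at h
    exact h
  rw [e, MultilinearMap.map_smul_univ]

/-- **The divisor ring `D²(B) ⊗ ℂ` is stable under every polynomial in a pull-back along an endomorphism.**
[cite: vanGeemen1994HodgeAV, §2.4] -/
theorem aeval_map_mem_divisorClassesSpan (f : B ⟶ B) (p : ℂ[X]) {c : complexBetti B.X (2 * 2)}
    (hc : c ∈ Literature.Barriers.HodgeConjecture.divisorClassesSpan B.X B.dim 2) :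
    Polynomial.aeval (complexBetti.map f.hom.hom.hom (2 * 2)).hom p c ∈
      Literature.Barriers.HodgeConjecture.divisorClassesSpan B.X B.dim 2 :=
  aeval_apply_mem_of_forall_mem _ _
    (fun _ hv => map_mem_divisorClassesSpan (AbelianVariety.isSmoothProjective_holds (A := B))
      (AbelianVariety.isSmoothProjective_holds (A := B)) f.hom.hom.hom hv) p hc

end Pullback

end Summit.HodgeConjecture.HodgeConjecture.WeilTypeLadder

end
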